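import Summits.CriticalPhenomena.SAWScalingLimit.Theorems.SAWLoopFugacityFlowAvoidanceLimitTaggiShift

/-!
# The massive interval of the loop-dressed SAW grows LINEARLY in the loop fugacity — registered helper
`isMassive_upTo_linear_shift` (helper of `stub_cornerEquicontinuous` / `stub_cornerLipschitz`, line
`saw-corner-germ`, crux `SAWLoopFugacityFlow.AvoidanceLimit`, stmt-CriticalPhenomena-10649)

Quantitative form of `isMassive_above_criticalFugacity_of_pos` (file `…TaggiShift`, whose constants were
already linear in `n` but hidden inside an `∃`): there is ONE constant `c > 0` (depending only on the
lattice, through Kesten's `q, ε` for the pattern `(V, Q)` and `x_c = 1/μ`) such that for every loop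
fugacity `0 < n ≤ 1` the corner-to-corner two-leg function of the strictly dilute loop-dressed SAW
`Z_{n,0,y}` across `[0, k]²` is massive for EVERY edge fugacity `y ∈ [0, x_c (1 + c n)]` — Taggi's linear
lower bound `x_c(n) ≥ x_c (1 + c n)` on the shift of the critical threshold (ECP 23 (2018), Thm 1.1,
eq. (1.5), there for the loop O(`n`) model), for the two-leg line of the line's critical curve
`critLine n`.

* `one_add_div_pow_le`: the elementary `(1 + t/(2q))^q ≤ 1 + t` for `0 ≤ t ≤ 1` (Bernoulli:
  `(1 + a)^q (1 - qa) ≤ (1 + a)^q (1 - a)^q = (1 - a²)^q ≤ 1`), which lets the `q`-th root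
  `γ = (1 + n x_c⁴)^{1/q}` of the plaquette penalty be replaced by the explicitly linear
  `γ = 1 + n x_c⁴/(2q)` (all the assembly needs is `γ^q ≤ 1 + n x_c⁴`);
* `isMassive_of_rates`: the tail estimate of `…TaggiShift` extracted — if the two rates `(1-ε)(1+η)`
  (few patterns) and `(1+η)²/γ` (many patterns) are `< 1`, every `y ≥ 0` with `μ y ≤ 1 + η` and
  `1 + n y⁴ ≥ β ≥ γ^q` is massive (`sum_fibre_le` layer by layer, geometric tail over lengths `≥ 2k`);
* `isMassive_upTo_linear_shift` (registered): with `c = min(ε, x_c⁴/(8q))` and `η = c n` both rates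
  are `< 1` for `0 < n ≤ 1` (`(1+cn)² ≤ 1 + 3cn < 1 + n x_c⁴/(2q)`), so `[0, x_c(1 + cn)]` is massive;
  below `x_c` as always by `stub_massiveBelow` + `isMassive_of_isMassive_zero`.

Sources: L. Taggi, *Shifted critical threshold in the loop O(n) model at arbitrarily small n*,
Electron. Commun. Probab. 23 (2018), paper no. 96, Thm 1.1 and eq. (1.5) [Taggi2018]; N. Madras,
G. Slade, *The Self-Avoiding Walk* (1993), Theorem 7.2.3 [MadrasSlade1993]. No definitions and no
notations; the registered statement is UNFOLDED into tree vocabulary.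
-/

noncomputable section

open Finset Filter Topology
open scoped symmDiff
open Literature.Probability.RandomPlanarGeometry Literature.Probability.LatticeModels
open Summit.CriticalPhenomena.SAWScalingLimit.Theorems.AvoidanceLimit.Anchor

namespace Summit.CriticalPhenomena.SAWScalingLimit.Theorems.AvoidanceLimit.Corner

section LinearShift

/-- **`(1 + t/(2q))^q ≤ 1 + t` for `q ≥ 1`, `0 ≤ t ≤ 1`.** With `a = t/(2q) ≤ 1/2`: Bernoulli gives
`1 - qa ≤ (1 - a)^q`, so `(1+a)^q (1 - t/2) ≤ ((1+a)(1-a))^q ≤ 1 ≤ (1 + t)(1 - t/2)`. [folklore] -/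
theorem one_add_div_pow_le {q : ℕ} (hq : 0 < q) {t : ℝ} (ht0 : 0 ≤ t) (ht1 : t ≤ 1) :
    (1 + t / (2 * q)) ^ q ≤ 1 + t := by
  set a : ℝ := t / (2 * q) with ha
  have hq1 : (1 : ℝ) ≤ q := by exact_mod_cast hq
  have ha0 : 0 ≤ a := div_nonneg ht0 (by positivity)
  have hqa : (q : ℝ) * a = t / 2 := by
    rw [ha]
    field_simp
  have ha1 : a ≤ 1 / 2 := by
    rw [ha, div_le_iff₀ (by positivity)]
    nlinarith
  have hB : 1 - (q : ℝ) * a ≤ (1 - a) ^ q := by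
    have h := one_add_mul_le_pow (show (-2 : ℝ) ≤ -a by linarith) q
    simpa [sub_eq_add_neg, mul_neg] using h
  have hP : (1 + a) ^ q * (1 - a) ^ q ≤ 1 := by
    rw [← mul_pow]
    exact pow_le_one₀ (by nlinarith) (by nlinarith)
  have h1 : (1 + a) ^ q * (1 - t / 2) ≤ 1 :=
    calc (1 + a) ^ q * (1 - t / 2) = (1 + a) ^ q * (1 - q * a) := by rw [hqa]
      _ ≤ (1 + a) ^ q * (1 - a) ^ q := mul_le_mul_of_nonneg_left hB (pow_nonneg (by linarith) _)
      _ ≤ 1 := hP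
  have h2 : 1 ≤ (1 + t) * (1 - t / 2) := by nlinarith
  exact le_of_mul_le_mul_right (h1.trans h2) (by linarith)

/-- **Massiveness from the two rates** (the tail estimate of `isMassive_above_criticalFugacity_of_pos`,
file `…TaggiShift`, extracted). Let `q, ε, N₀` be as in Kesten's pattern theorem for `(V, Q)`
(`SAW.Zd.thm723 0`), `c_N ≤ K((1+η)μ)^N` with `K, η ≥ 0`, and `β > 1`, `γ ≥ 1` with `γ^q ≤ β`. If both
rates `(1-ε)(1+η)` and `(1+η)²/γ` are `< 1`, then every edge fugacity `y ≥ 0` with `μ y ≤ 1 + η` and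
`β ≤ 1 + n y⁴` (`n ≥ 0`) is massive: the length-`N` layer of the penalised path sum weighs
`≤ (1+K)θ^N`, `θ` the larger rate (`sum_fibre_le`), and the geometric tail over `N ≥ 2k` is
`≤ θ^k = e^{-mk}` eventually, `m = -log θ`. [cite: Taggi2018, proof of Thm 1.1] -/
theorem isMassive_of_rates {n : ℝ} (hn : 0 ≤ n) {q : ℕ} (hq : 0 < q) {ε : ℝ} (hε1 : ε < 1) {N₀ : ℕ}
    (hPT : ∀ N, N₀ ≤ N → (#((SAW.Zd.saws 2 N).filter (fun ω => SAW.Zd.vCount N ω ≤ N / q)) : ℝ) ≤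
      ((1 - ε) * SAW.connectiveConstant) ^ N)
    {K η : ℝ} (hK0 : 0 ≤ K) (hη : 0 ≤ η)
    (hK : ∀ N : ℕ, (SAW.Zd.count 2 N : ℝ) ≤ K * ((1 + η) * SAW.connectiveConstant) ^ N)
    {β γ : ℝ} (hβ1 : 1 < β) (hγ1 : 1 ≤ γ) (hγq : γ ^ q ≤ β)
    (hθ₁1 : (1 - ε) * (1 + η) < 1) (hθ₂1 : (1 + η) ^ 2 / γ < 1)
    {y : ℝ} (hy0 : 0 ≤ y) (hμy : SAW.connectiveConstant * y ≤ 1 + η) (hβy : β ≤ 1 + n * y ^ 4) :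
    ∃ m : ℝ, 0 < m ∧ ∀ᶠ k : ℕ in atTop,
      twoLegDim n 0 y (zdGraph 2) ((box 2 k).filter fun v => ∀ i, 0 ≤ v i) 0 (SAW.diag k) ≤
        Real.exp (-(m * k)) := by
  classical
  set θ₁ : ℝ := (1 - ε) * (1 + η) with hθ₁def
  set θ₂ : ℝ := (1 + η) ^ 2 / γ with hθ₂def
  have hθ₁0 : 0 < θ₁ := mul_pos (by linarith) (by linarith)
  have hθ₂0 : 0 < θ₂ := div_pos (by positivity) (by linarith)
  set θ : ℝ := max θ₁ θ₂ with hθdef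
  have hθ0 : 0 < θ := lt_max_of_lt_left hθ₁0
  have hθ1 : θ < 1 := max_lt hθ₁1 hθ₂1
  refine ⟨-Real.log θ, neg_pos.2 (Real.log_neg hθ0 hθ1), ?_⟩
  -- eventually `(1 + K)/(1 - θ) · θ^k ≤ 1`
  have hev : ∀ᶠ k : ℕ in atTop, (1 + K) / (1 - θ) * θ ^ k ≤ 1 := by
    have ht : Tendsto (fun k : ℕ => (1 + K) / (1 - θ) * θ ^ k) atTop (𝓝 ((1 + K) / (1 - θ) * 0)) :=
      (tendsto_pow_atTop_nhds_zero_of_lt_one hθ0.le hθ1).const_mul _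
    rw [mul_zero] at ht
    exact ht.eventually (eventually_le_nhds one_pos)
  filter_upwards [hev, eventually_ge_atTop N₀, eventually_ge_atTop 1] with k hk hkN hk1
  have hexp : Real.exp (-(-Real.log θ * k)) = θ ^ k := by
    rw [neg_mul, neg_neg, mul_comm, Real.exp_nat_mul, Real.exp_log hθ0]
  rw [hexp]
  set Λ := (box 2 k).filter (fun v => ∀ i, 0 ≤ v i) with hΛdef
  set P := DiluteLoopModel.pathsIn (zdGraph 2) Λ 0 (SAW.diag k) with hPdef
  -- every path from `0` to `(k, k)` has length `≥ 2k ≥ k ≥ N₀`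
  have hlen : ∀ p ∈ P, 2 * k ≤ p.length := fun p _ => by
    have h := SAW.Zd.normOne_le_length p
    rwa [normOne_diag] at h
  have hfib : ∀ N ∈ P.image (fun p => p.length),
      ∑ p ∈ P.filter (fun p => p.length = N),
          y ^ p.length / (1 + n * y ^ 4) ^ SAW.Zd.vCount p.length (fun i => p.getVert i - 0) ≤
        (1 + K) * θ ^ N := by
    intro N hN
    obtain ⟨p, hp, rfl⟩ := mem_image.1 hN
    have hN₀ : N₀ ≤ p.length := hkN.trans ((Nat.le_mul_of_pos_left k two_pos).trans (hlen p hp))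
    refine (sum_fibre_le hq hε1 hPT hK0 hη hK hβ1 hγ1 hγq hy0 hμy hβy Λ (SAW.diag k) hN₀).trans ?_
    calc θ₁ ^ p.length + K * θ₂ ^ p.length ≤ θ ^ p.length + K * θ ^ p.length :=
          add_le_add (pow_le_pow_left₀ hθ₁0.le (le_max_left _ _) _)
            (mul_le_mul_of_nonneg_left (pow_le_pow_left₀ hθ₂0.le (le_max_right _ _) _) hK0)
      _ = (1 + K) * θ ^ p.length := by ring
  have hIco : P.image (fun p => p.length) ⊆ Ico (2 * k) (P.sup (fun p => p.length) + 1) := by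
    intro N hN
    obtain ⟨p, hp, rfl⟩ := mem_image.1 hN
    exact mem_Ico.2 ⟨hlen p hp, Nat.lt_succ_of_le (le_sup (f := fun p => p.length) hp)⟩
  calc twoLegDim n 0 y (zdGraph 2) Λ 0 (SAW.diag k)
      ≤ ∑ p ∈ P, y ^ p.length / (1 + n * y ^ 4) ^ SAW.Zd.vCount p.length (fun i => p.getVert i - 0) :=
        twoLegDim_le_sum_paths_penalty n y hn hy0 Λ 0 (SAW.diag k) (zero_ne_diag hk1)
    _ = ∑ N ∈ P.image (fun p => p.length), ∑ p ∈ P.filter (fun p => p.length = N),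
          y ^ p.length / (1 + n * y ^ 4) ^ SAW.Zd.vCount p.length (fun i => p.getVert i - 0) :=
        (sum_fiberwise_of_maps_to (fun p hp => mem_image_of_mem _ hp) _).symm
    _ ≤ ∑ N ∈ P.image (fun p => p.length), (1 + K) * θ ^ N := sum_le_sum hfib
    _ ≤ ∑ N ∈ Ico (2 * k) (P.sup (fun p => p.length) + 1), (1 + K) * θ ^ N :=
        sum_le_sum_of_subset_of_nonneg hIco fun N _ _ =>
          mul_nonneg (by linarith) (pow_nonneg hθ0.le _)
    _ = (1 + K) * ∑ N ∈ Ico (2 * k) (P.sup (fun p => p.length) + 1), θ ^ N := (mul_sum _ _ _).symm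
    _ ≤ (1 + K) * (θ ^ (2 * k) / (1 - θ)) :=
        mul_le_mul_of_nonneg_left (geom_sum_Ico_le_of_lt_one hθ0.le hθ1) (by linarith)
    _ = (1 + K) / (1 - θ) * θ ^ k * θ ^ k := by rw [two_mul, pow_add]; ring
    _ ≤ 1 * θ ^ k := mul_le_mul_of_nonneg_right hk (pow_nonneg hθ0.le _)
    _ = θ ^ k := one_mul _

/-- **Registered helper · the massive interval grows linearly in the loop fugacity** (Taggi 2018,
eq. (1.5), for the two-leg line of the strictly dilute loop-dressed SAW on `ℤ²`): there is `c > 0`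
such that for every `0 < n ≤ 1` and every edge fugacity `y ∈ [0, x_c (1 + c n)]` the corner-to-corner
two-leg function `twoLegDim n 0 y ℤ² [0,k]² 0 (k,k)` is `≤ e^{-mk}` for some `m > 0` and all large `k`.
Constants: `q, ε` from Kesten's pattern theorem for `(V, Q)` (`SAW.Zd.thm723 0`),
`c = min(ε, x_c⁴/(8q))`; at loop fugacity `n` the plaquette penalty base is `β = 1 + n x_c⁴`, its
linearised `q`-th root `γ = 1 + n x_c⁴/(2q)` (`one_add_div_pow_le`), the margin `η = c n`, and the two
rates `(1-ε)(1+cn) ≤ 1 - ε² < 1`, `(1+cn)²/γ < 1`; then `isMassive_of_rates`. Below `x_c`: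
`stub_massiveBelow` and `isMassive_of_isMassive_zero`. [cite: Taggi2018, Thm 1.1 and eq. (1.5)] -/
theorem isMassive_upTo_linear_shift :
    ∃ c : ℝ, 0 < c ∧ ∀ n : ℝ, 0 < n → n ≤ 1 →
      ∀ y ∈ Set.Icc 0 (SAW.criticalFugacity * (1 + c * n)), ∃ m : ℝ, 0 < m ∧
        ∀ᶠ k : ℕ in atTop, twoLegDim n 0 y (zdGraph 2) ((box 2 k).filter fun v => ∀ i, 0 ≤ v i) 0 (SAW.diag k) ≤
          Real.exp (-(m * k)) := by
  classical
  -- Kesten's pattern theorem for `(V, Q)` on `ℤ²`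
  obtain ⟨q, hq, ε, hε, hε1, N₀, hPT⟩ := SAW.Zd.thm723 0
  have hPT' : ∀ N, N₀ ≤ N → (#((SAW.Zd.saws 2 N).filter (fun ω => SAW.Zd.vCount N ω ≤ N / q)) : ℝ) ≤
      ((1 - ε) * SAW.connectiveConstant) ^ N := fun N hN => hPT N hN
  have hμ : 0 < SAW.connectiveConstant := SAW.Zd.connectiveConstant_pos 2
  have hxc : SAW.criticalFugacity = SAW.connectiveConstant⁻¹ := rfl
  obtain ⟨hxc0, hxc1⟩ := SAW.criticalFugacity_pos_lt_one'
  have hμxc : SAW.connectiveConstant * SAW.criticalFugacity = 1 := by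
    rw [hxc, mul_inv_cancel₀ hμ.ne']
  have hq0 : (0 : ℝ) < q := by exact_mod_cast hq
  have hx40 : 0 < SAW.criticalFugacity ^ 4 := pow_pos hxc0 4
  have hx4 : SAW.criticalFugacity ^ 4 ≤ 1 := pow_le_one₀ hxc0.le hxc1.le
  -- the constant
  set c : ℝ := min ε (SAW.criticalFugacity ^ 4 / (8 * q)) with hcdef
  have hc0 : 0 < c := lt_min hε (by positivity)
  have hcε : c ≤ ε := min_le_left _ _
  have hcq : c ≤ SAW.criticalFugacity ^ 4 / (8 * q) := min_le_right _ _
  refine ⟨c, hc0, fun n hn hn1 y hy => ?_⟩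
  rcases lt_or_ge y SAW.criticalFugacity with hlt | hge
  · -- below `x_c`: the pure SAW is massive and loops only lower the two-leg function
    exact isMassive_of_isMassive_zero n y hn.le hy.1 (stub_massiveBelow y hy.1 hlt)
  -- the penalty base `β = 1 + n x_c⁴` and its linearised `q`-th root `γ = 1 + n x_c⁴/(2q)`
  set β : ℝ := 1 + n * SAW.criticalFugacity ^ 4 with hβdef
  have hβ1 : 1 < β := by
    have := mul_pos hn hx40
    rw [hβdef]
    linarith
  have ht0 : 0 ≤ n * SAW.criticalFugacity ^ 4 := mul_nonneg hn.le hx40.le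
  have ht1 : n * SAW.criticalFugacity ^ 4 ≤ 1 := by nlinarith
  set γ : ℝ := 1 + n * SAW.criticalFugacity ^ 4 / (2 * q) with hγdef
  have hA : n * SAW.criticalFugacity ^ 4 / (2 * q) = 4 * (n * SAW.criticalFugacity ^ 4 / (8 * q)) := by
    field_simp
    ring
  have hApos : 0 < n * SAW.criticalFugacity ^ 4 / (8 * q) := by positivity
  have hγ1 : 1 ≤ γ := by
    rw [hγdef, hA]
    linarith
  have hγq : γ ^ q ≤ β := one_add_div_pow_le hq ht0 ht1
  -- the margin `η = c n`
  set η : ℝ := c * n with hηdef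
  have hη0 : 0 < η := mul_pos hc0 hn
  have hηε : η ≤ ε := (mul_le_of_le_one_right hc0.le hn1).trans hcε
  have hη1 : η ≤ 1 := hηε.trans hε1.le
  have hηA : η ≤ n * SAW.criticalFugacity ^ 4 / (8 * q) :=
    calc η = c * n := hηdef
      _ ≤ SAW.criticalFugacity ^ 4 / (8 * q) * n := mul_le_mul_of_nonneg_right hcq hn.le
      _ = n * SAW.criticalFugacity ^ 4 / (8 * q) := by ring
  obtain ⟨K, hK1, hK⟩ := SAW.Zd.count_le_mul_pow 2 hη0
  have hK' : ∀ N : ℕ, (SAW.Zd.count 2 N : ℝ) ≤ K * ((1 + η) * SAW.connectiveConstant) ^ N :=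
    fun N => hK N
  -- the two rates are `< 1`
  have hθ₁1 : (1 - ε) * (1 + η) < 1 := by
    have h1 : (1 - ε) * (1 + η) ≤ (1 - ε) * (1 + ε) := mul_le_mul_of_nonneg_left (by linarith) (by linarith)
    nlinarith [mul_pos hε hε]
  have hθ₂1 : (1 + η) ^ 2 / γ < 1 := by
    rw [div_lt_one (by linarith), hγdef, hA]
    nlinarith [mul_nonneg (sub_nonneg.2 hη1) hη0.le]
  -- the fugacity window `x_c ≤ y ≤ x_c (1 + c n)`
  have hμy : SAW.connectiveConstant * y ≤ 1 + η :=
    calc SAW.connectiveConstant * y ≤ SAW.connectiveConstant * (SAW.criticalFugacity * (1 + η)) :=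
          mul_le_mul_of_nonneg_left hy.2 hμ.le
      _ = 1 + η := by rw [← mul_assoc, hμxc, one_mul]
  have hβy : β ≤ 1 + n * y ^ 4 := by
    have h := mul_le_mul_of_nonneg_left (pow_le_pow_left₀ hxc0.le hge 4) hn.le
    rw [hβdef]
    linarith
  exact isMassive_of_rates hn.le hq hε1 hPT' (zero_le_one.trans hK1) hη0.le hK' hβ1 hγ1 hγq hθ₁1 hθ₂1
    hy.1 hμy hβy

end LinearShift

end Summit.CriticalPhenomena.SAWScalingLimit.Theorems.AvoidanceLimit.Corner

end
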